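import Literature.MathematicalPhysics.KineticTheory.CollisionWindowBookkeeping
import Literature.MathematicalPhysics.KineticTheory.EvenStatTruncationBound
import Summits.AtomisticToContinuum.HydrodynamicLimit.Theorems.InformationPercolationEngineCollisionRateCollisionSumByParticles
import Summits.AtomisticToContinuum.HydrodynamicLimit.Theorems.JParityClosureEvenStressEnskogKineticEnergyTight
import HarnessLib

/-!
# `InformationPercolationEngine.CollisionRate` — the collision-side window reduction (crux
# stmt-AtomisticToContinuum-13481, line `Sketch`, card `hazard-fairness-compensator`, stub S4a
# `stub_windowReductionCollision`)

Helper file (`--supports stmt-AtomisticToContinuum-13481`) proving the registered stub `stub_windowReductionCollision`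
(S4a) of the lead's checked skeleton for the crux
`Summit.AtomisticToContinuum.HydrodynamicLimit.Theses.InformationPercolationEngine.CollisionRate`, line `Sketch`.
The statement is spelled exactly as registered; its antecedent is the line's stub S5 (`stub_windowCountSquareTight`:
the squared windowed collision counts `(ε/(N+1)) Σ_{i,k} D_{i,k}²` are tight under the evolved local Gibbs law), written
out verbatim.

Content.  Given S5, for every cutoff level `η₀' > 0` and continuous positive profiles there is `σ₀` such that for
`0 < σ < σ₀`, every flow, `τ > 0`, continuous `χ`, continuous `g` vanishing on `[η₀', ∞)`, `η, δ > 0`, `r > 0`, `a > 0`,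
there is `r'₀` such that for `0 < r' < r'₀` and all large `N`
`P_{LG}(|K_N[χ g(σ³ρ_r)·1] − WS(h*, D)| > η) ≤ δ`:
the crux's constant-mark collision sum is the hazard-weighted windowed collision count up to a small error in
probability.  The proof is the window bookkeeping of
`Literature/MathematicalPhysics/KineticTheory/CollisionWindowBookkeeping.lean` run on the good set:

* `abs_collisionSum_sub_windowSum_le` (deterministic core): re-index the collision sum by particles
  (`Theorems.CollisionRate.stub_collisionSumByParticles`, H3) and apply `abs_particleSum_sub_windowSum_le` — tile
  `[0, τ)` by the windows; a collision in a GOOD window (path length of the sphere over the window `≤ λ`) has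
  frozen-weight error `≤ C_g η' + C_χ η'` (`abs_weight_sub_hazardWeight_le`: moduli of continuity of `χ` on
  `[0,τ] × 𝕋³` and of `g` on `[0, σ³·3/(πr³)]`, displacement `≤` path length, a point is within `r'` of its cell
  centre, the mollified density is `3/(πr⁴)`-Lipschitz, the mean displacement of all spheres over a window is
  `≤ w(½ + E/(N+1))`); the collisions of a BAD window cost `Cθ D² + (C/(θλ)) · (path length)` (AM–GM); the at most
  two collisions at the time `τ` cost `2Cε`; the total path length is `≤ τ((N+1)/2 + E)` (energy conservation):
  `|K − WS| ≤ 2Cε + (η'' + Cθ) · (ε/(N+1)) Σ D² + (C/(θλ)) ε τ (½ + E/(N+1)) ≤ η/4 + η/2 + η/4`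
  on the event `{(ε/(N+1)) Σ D² ≤ K_b} ∩ {E/(N+1) ≤ K_E}` for suitable `η'`, `θ`, `r'`, `N`;
* `stub_windowReductionCollision`: the constants — `C_χ = sup|χ|`, `C_g = sup|g|`; `K_b` from S5 and `K_E` from
  `Theorems.EvenStressEnskog.stub_kineticEnergyTight`, both at confidence `δ/4`; `η' = η/(4(K_b+1)(C_g+C_χ+1))`,
  `θ = η/(4(K_b+1)(C_χC_g+1))`; the moduli `λ_χ`, `λ_g` (compactness); `λ = min(λ_χ/4, λ_g/(4M))`,
  `M = σ³·3/(πr⁴)`; `r'₀ = min(λ_χ/4, λ_g/(8M))`; `N₀` so large that `(N+1)^{-1/3}` (hence `ε = σ(N+1)^{-1/3}` and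
  `w ≤ a(N+1)^{-1/3}`) is below the four remaining thresholds (`exists_nat_rpow_neg_third_le`) — then the event
  inclusion `{η < |K − WS|} ⊆ goodᶜ ∪ {K_b < (ε/(N+1)) Σ D²} ∪ {K_E < E/(N+1)}` and the union bound
  (`localGibbsLaw_compl_good_eq_zero`: the bad set is `LG`-null).

No smallness of `a` or `r` is used.  prover-line-stmt-AtomisticToContinuum-13481-0 (stub worker S4a).
-/

noncomputable section

open MeasureTheory Set Filter
open scoped BigOperators ENNReal

namespace Summit.AtomisticToContinuum.HydrodynamicLimit.Theorems.CollisionRate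

open Literature.Analysis.FluidPDE Literature.MathematicalPhysics.KineticTheory

/-- Threshold arithmetic: `x ≤ y·c`, `c ≤ A / (y D)` and `B ≤ D` give `B x ≤ A` (`0 ≤ x`, `0 < y, D`).
[folklore] -/
theorem mul_le_of_le_mul_of_le_div {x y c A B D : ℝ} (hx : 0 ≤ x) (hBD : B ≤ D) (hD : 0 < D)
    (hy : 0 < y) (hxy : x ≤ y * c) (hc : c ≤ A / (y * D)) : B * x ≤ A := by
  have h1 : x ≤ A / D := by
    calc x ≤ y * c := hxy
      _ ≤ y * (A / (y * D)) := mul_le_mul_of_nonneg_left hc hy.le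
      _ = A / D := by field_simp
  calc B * x ≤ D * (A / D) := mul_le_mul hBD h1 hx hD.le
    _ = A := by field_simp

/-- Threshold arithmetic: `X · (η / (4 (K+1)(X+1))) · K ≤ η/4` for `X, K, η ≥ 0`. [folklore] -/
theorem mul_div_mul_le_quarter {X K η : ℝ} (hX : 0 ≤ X) (hK : 0 ≤ K) (hη : 0 ≤ η) :
    X * (η / (4 * (K + 1) * (X + 1))) * K ≤ η / 4 := by
  rw [show X * (η / (4 * (K + 1) * (X + 1))) * K = η / 4 * ((X / (X + 1)) * (K / (K + 1))) by
    field_simp]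
  refine mul_le_of_le_one_right (by positivity) ?_
  have h1 : X / (X + 1) ≤ 1 := by rw [div_le_one (by positivity)]; linarith
  have h2 : K / (K + 1) ≤ 1 := by rw [div_le_one (by positivity)]; linarith
  exact mul_le_one₀ h1 (by positivity) h2

/-- **The deterministic core of the window reduction.**  On a good orbit (`0 < σ < 1/2`), with `|χ| ≤ C_χ` on
`[0,τ] × 𝕋³`, `|g| ≤ C_g` on `[0, ∞)`, `η'`-moduli `λ_χ` of `χ` and `λ_g` of `g` (on `[0, σ³·3/(πr³)]`), a good-window
threshold `λ`, an AM–GM parameter `θ`, the window length and the cell size below the moduli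
(`w ≤ λ_χ`, `λ + r' ≤ λ_χ`, `σ³ (3/(πr⁴)) (w(½ + K_E) + λ + 2r') ≤ λ_g`), and the three error terms of
`abs_particleSum_sub_windowSum_le` at most `η/4`, `η/2`, `η/4` on the event
`{(ε/(N+1)) Σ D² ≤ K_b} ∩ {E/(N+1) ≤ K_E}`: `|collisionSum(χ g(σ³ρ_r)·1) − WS(h*, D)| ≤ η`
(re-indexing by particles: `stub_collisionSumByParticles`). [folklore] -/
theorem abs_collisionSum_sub_windowSum_le {σ : ℝ} {N : ℕ}
    (Φ : HardSphereFlow (Torus.geometry (Fin 3)) (hsDiameter σ N) (N + 1)) {z : Config (N + 1) (Fin 3) T3}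
    (hz : z ∈ Φ.good) (hσ : 0 < σ) (hσ2 : σ < 1 / 2) {τ a r r' : ℝ} (hτ : 0 < τ) (ha : 0 < a) (hr : 0 < r)
    (hr' : 0 < r') (χ : ℝ × T3 → ℝ) (g : ℝ → ℝ) {Cχ Cg η' lχ lg KE Kb lam θ η : ℝ} (hCχ0 : 0 ≤ Cχ)
    (hCg0 : 0 ≤ Cg) (hCg : ∀ x, 0 ≤ x → |g x| ≤ Cg) (hCχ : ∀ p : ℝ × T3, p.1 ∈ Icc 0 τ → |χ p| ≤ Cχ)
    (hχmod : ∀ p q : ℝ × T3, p.1 ∈ Icc 0 τ → q.1 ∈ Icc 0 τ → dist p q ≤ lχ → |χ p - χ q| ≤ η')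
    (hgmod : ∀ x y : ℝ, x ∈ Icc 0 (σ ^ 3 * (3 / (Real.pi * r ^ 3))) →
      y ∈ Icc 0 (σ ^ 3 * (3 / (Real.pi * r ^ 3))) → |x - y| ≤ lg → |g x - g y| ≤ η')
    (hE : ((N : ℝ) + 1)⁻¹ * configEnergy z ≤ KE)
    (hS : hsDiameter σ N / (N + 1 : ℝ) *
      ∑ i : Fin (N + 1), ∑ k ∈ Finset.range (windowNum N τ a), windowCollisions σ N Φ τ a i k z ^ 2 ≤ Kb)
    (hη' : 0 ≤ η') (hθ : 0 < θ) (hlam : 0 < lam) (hw : windowLen N τ a ≤ lχ) (hlr : lam + r' ≤ lχ)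
    (hdens : σ ^ 3 * (3 / (Real.pi * r ^ 4)) * (windowLen N τ a * (1 / 2 + KE) + lam + 2 * r') ≤ lg)
    (h1 : 2 * (Cχ * Cg) * hsDiameter σ N ≤ η / 4) (h2 : (Cg * η' + Cχ * η' + Cχ * Cg * θ) * Kb ≤ η / 2)
    (h3 : Cχ * Cg / (θ * lam) * (hsDiameter σ N * τ * (1 / 2 + KE)) ≤ η / 4) :
    |Literature.MathematicalPhysics.KineticTheory.collisionSum σ N Φ τ χ g (fun _ => 1) r z -
        windowSum σ N Φ r' τ a (hazardWeight σ N χ g r r' τ a) (windowCollisions σ N Φ τ a) z| ≤ η := by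
  -- H3: the collision sum re-indexed by particles
  rw [stub_collisionSumByParticles σ N Φ τ χ g r z hσ hσ2 hz]
  -- the three hypotheses of the pathwise bound
  have hF : ∀ i : Fin (N + 1), ∀ s ∈ Icc (0 : ℝ) τ, |χ (s, (Φ.flow s z i).1) *
      g (σ ^ 3 * mollDensity r (Φ.flow s z) (Φ.flow s z i).1)| ≤ Cχ * Cg := by
    intro i s hs
    rw [abs_mul]
    exact mul_le_mul (hCχ _ hs) (hCg _ (mul_nonneg (pow_nonneg hσ.le 3) (mollDensity_nonneg hr _ _)))
      (abs_nonneg _) hCχ0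
  have hh : ∀ i : Fin (N + 1), ∀ k < windowNum N τ a,
      |hazardWeight σ N χ g r r' τ a i k (coarseStateAt σ N Φ r' τ a k z)| ≤ Cχ * Cg := by
    intro i k hk
    rw [hazardWeight_coarseStateAt_eq σ N Φ χ g r r' τ a i hk z, abs_mul]
    exact mul_le_mul (hCχ _ (windowStart_mem_Icc N hτ ha hk))
      (hCg _ (mul_nonneg (pow_nonneg hσ.le 3) (coarseMollDensity_nonneg N hr r' _ i))) (abs_nonneg _) hCχ0
  have hgw : ∀ i : Fin (N + 1), ∀ k < windowNum N τ a, ∀ s ∈ window N τ a k,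
      (∫ u in ((k : ℝ) * windowLen N τ a)..(((k : ℝ) + 1) * windowLen N τ a), ‖(Φ.flow u z i).2‖) ≤ lam →
      |χ (s, (Φ.flow s z i).1) * g (σ ^ 3 * mollDensity r (Φ.flow s z) (Φ.flow s z i).1) -
        hazardWeight σ N χ g r r' τ a i k (coarseStateAt σ N Φ r' τ a k z)| ≤ Cg * η' + Cχ * η' :=
    fun i k hk s hs hP => abs_weight_sub_hazardWeight_le σ N Φ hz hσ.le hτ ha hr hr' χ g hCg hCχ
      hχmod hgmod hE hw hlr hdens hk hs hP
  have hη'0 : 0 ≤ Cg * η' + Cχ * η' := by positivity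
  have key := abs_particleSum_sub_windowSum_le σ N Φ hz hσ hτ ha r'
    (fun i s => χ (s, (Φ.flow s z i).1) * g (σ ^ 3 * mollDensity r (Φ.flow s z) (Φ.flow s z i).1))
    (hazardWeight σ N χ g r r' τ a) (mul_nonneg hCχ0 hCg0) hη'0 hθ hlam hF hh hgw
  refine key.trans ?_
  have t2 : (Cg * η' + Cχ * η' + Cχ * Cg * θ) * (hsDiameter σ N / (N + 1 : ℝ) *
      ∑ i : Fin (N + 1), ∑ k ∈ Finset.range (windowNum N τ a), windowCollisions σ N Φ τ a i k z ^ 2) ≤ η / 2 :=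
    (mul_le_mul_of_nonneg_left hS (by positivity)).trans h2
  have t3 : Cχ * Cg / (θ * lam) * (hsDiameter σ N * τ * (1 / 2 + ((N : ℝ) + 1)⁻¹ * configEnergy z)) ≤ η / 4 := by
    refine le_trans ?_ h3
    have hε0 : 0 ≤ hsDiameter σ N := (hsDiameter_pos hσ N).le
    gcongr
  linarith

/-- **S4a · window reduction, collision side** (registered stub `stub_windowReductionCollision` of line `Sketch`,
card `hazard-fairness-compensator`, crux `InformationPercolationEngine.CollisionRate`; antecedent = stub S5
`stub_windowCountSquareTight` verbatim).  Given the tightness of the squared windowed collision counts, for every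
cutoff level `η₀' > 0` and continuous positive profiles `∃ σ₀ ∀ σ < σ₀ ∀ Φ ∀ τ > 0`, continuous `χ`, continuous `g`
vanishing on `[η₀', ∞)`, `∀ η δ > 0 ∀ r > 0 ∀ a > 0 ∃ r'₀ ∀ r' < r'₀ ∃ N₀ ∀ N ≥ N₀`:
`P_{LG}(|collisionSum(χ g(σ³ρ_r)·1) − WS(h*, D)| > η) ≤ δ`. [folklore] -/
theorem stub_windowReductionCollision :
    (∀ (a₀ θ₀ : T3 → ℝ) (u₀ : T3 → V3), Continuous a₀ → Continuous θ₀ → Continuous u₀ →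
      (∀ x, 0 < a₀ x) → (∀ x, 0 < θ₀ x) → ∃ σ₀ : ℝ, 0 < σ₀ ∧ ∀ σ : ℝ, 0 < σ → σ < σ₀ →
      ∀ Φ : (N : ℕ) → HardSphereFlow (Torus.geometry (Fin 3)) (hsDiameter σ N) (N + 1),
      ∀ τ : ℝ, 0 < τ → ∀ a : ℝ, 0 < a → ∀ δ : ℝ, 0 < δ → ∃ Kb : ℝ, ∃ N₀ : ℕ, ∀ N : ℕ, N₀ ≤ N →
        localGibbsLaw σ a₀ u₀ θ₀ N (Φ N)
          {z | Kb < hsDiameter σ N / (N + 1 : ℝ) *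
              ∑ i : Fin (N + 1), ∑ k ∈ Finset.range (windowNum N τ a), windowCollisions σ N (Φ N) τ a i k z ^ 2}
          ≤ ENNReal.ofReal δ) →
    ∀ η₀' : ℝ, 0 < η₀' → ∀ (a₀ θ₀ : T3 → ℝ) (u₀ : T3 → V3), Continuous a₀ → Continuous θ₀ → Continuous u₀ →
      (∀ x, 0 < a₀ x) → (∀ x, 0 < θ₀ x) → ∃ σ₀ : ℝ, 0 < σ₀ ∧ ∀ σ : ℝ, 0 < σ → σ < σ₀ →
      ∀ Φ : (N : ℕ) → HardSphereFlow (Torus.geometry (Fin 3)) (hsDiameter σ N) (N + 1),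
      ∀ τ : ℝ, 0 < τ → ∀ χ : ℝ × T3 → ℝ, Continuous χ → ∀ g : ℝ → ℝ, Continuous g →
      (∀ x, η₀' ≤ x → g x = 0) →
      ∀ η δ : ℝ, 0 < η → 0 < δ → ∀ r : ℝ, 0 < r → ∀ a : ℝ, 0 < a →
      ∃ r'₀ : ℝ, 0 < r'₀ ∧ ∀ r' : ℝ, 0 < r' → r' < r'₀ → ∃ N₀ : ℕ, ∀ N : ℕ, N₀ ≤ N →
        localGibbsLaw σ a₀ u₀ θ₀ N (Φ N)
          {z | η < |Literature.MathematicalPhysics.KineticTheory.collisionSum σ N (Φ N) τ χ g (fun _ => 1) r z -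
              windowSum σ N (Φ N) r' τ a (hazardWeight σ N χ g r r' τ a) (windowCollisions σ N (Φ N) τ a) z|}
          ≤ ENNReal.ofReal δ := by
  intro h5 η₀' hη₀' a₀ θ₀ u₀ ha hθ hu ha0 hθ0
  obtain ⟨σ₅, hσ₅, H5⟩ := h5 a₀ θ₀ u₀ ha hθ hu ha0 hθ0
  obtain ⟨σE, hσE, HE⟩ := Theorems.EvenStressEnskog.stub_kineticEnergyTight a₀ θ₀ u₀ ha hθ hu ha0 hθ0
  refine ⟨min (min σ₅ σE) (1 / 2), by positivity, ?_⟩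
  intro σ hσ hσlt Φ τ hτ χ hχ g hg hg0 η δ hη hδ r hr a ha'
  have hσ₅' : σ < σ₅ := lt_of_lt_of_le hσlt ((min_le_left _ _).trans (min_le_left _ _))
  have hσE' : σ < σE := lt_of_lt_of_le hσlt ((min_le_left _ _).trans (min_le_right _ _))
  have hσ2 : σ < 1 / 2 := lt_of_lt_of_le hσlt (min_le_right _ _)
  -- bounds of `χ` on `[0,τ] × 𝕋³` and of `g` on `[0, ∞)`
  obtain ⟨Cχ, hCχ0, hCχ⟩ : ∃ Cχ : ℝ, 0 ≤ Cχ ∧ ∀ p : ℝ × T3, p.1 ∈ Icc 0 τ → |χ p| ≤ Cχ := by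
    have hK : IsCompact (Icc (0 : ℝ) τ ×ˢ (univ : Set T3)) := isCompact_Icc.prod isCompact_univ
    obtain ⟨C, hC⟩ := hK.exists_bound_of_continuousOn hχ.continuousOn
    refine ⟨max C 0, le_max_right _ _, fun p hp => ?_⟩
    have := hC p ⟨hp, mem_univ _⟩
    rw [Real.norm_eq_abs] at this
    exact this.trans (le_max_left _ _)
  obtain ⟨Cg, hCg0, hCg⟩ : ∃ Cg : ℝ, 0 ≤ Cg ∧ ∀ x : ℝ, 0 ≤ x → |g x| ≤ Cg := by
    obtain ⟨C, hC⟩ :=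
      (isCompact_Icc (a := (0 : ℝ)) (b := max η₀' 0)).exists_bound_of_continuousOn hg.continuousOn
    refine ⟨max C 0, le_max_right _ _, fun x hx => ?_⟩
    by_cases hx' : η₀' ≤ x
    · rw [hg0 x hx', abs_zero]; exact le_max_right _ _
    · have := hC x ⟨hx, (le_of_lt (not_le.1 hx')).trans (le_max_left _ _)⟩
      rw [Real.norm_eq_abs] at this
      exact this.trans (le_max_left _ _)
  -- the a-priori inputs at confidence `δ/4`: squared window counts (S5) and kinetic energy per particle
  obtain ⟨Kb, N₅, hS5⟩ := H5 σ hσ hσ₅' Φ τ hτ a ha' (δ / 4) (by positivity)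
  obtain ⟨KE, NE, hKE⟩ := HE σ hσ hσE' Φ (δ / 4) (by positivity)
  obtain ⟨Kb', hKb', hKb'0⟩ : ∃ Kb' : ℝ, Kb ≤ Kb' ∧ 0 ≤ Kb' := ⟨max Kb 0, le_max_left _ _, le_max_right _ _⟩
  obtain ⟨KE', hKE', hKE'0⟩ : ∃ KE' : ℝ, KE ≤ KE' ∧ 0 ≤ KE' := ⟨max KE 0, le_max_left _ _, le_max_right _ _⟩
  -- accuracy of the moduli and the AM–GM parameter (against `Kb'`)
  obtain ⟨η', hη'eq, hη'0⟩ : ∃ η' : ℝ, η' = η / (4 * (Kb' + 1) * (Cg + Cχ + 1)) ∧ 0 < η' :=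
    ⟨_, rfl, by positivity⟩
  obtain ⟨θ, hθeq, hθ0⟩ : ∃ θ : ℝ, θ = η / (4 * (Kb' + 1) * (Cχ * Cg + 1)) ∧ 0 < θ :=
    ⟨_, rfl, by positivity⟩
  have h2 : (Cg * η' + Cχ * η' + Cχ * Cg * θ) * Kb' ≤ η / 2 := by
    have e1 : (Cg + Cχ) * η' * Kb' ≤ η / 4 := by
      rw [hη'eq]; exact mul_div_mul_le_quarter (by positivity) hKb'0 hη.le
    have e2 : Cχ * Cg * θ * Kb' ≤ η / 4 := by
      rw [hθeq]; exact mul_div_mul_le_quarter (by positivity) hKb'0 hη.le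
    linarith
  -- moduli of continuity of `χ` on `[0,τ] × 𝕋³` and of `g` on `[0, σ³ · 3/(πr³)]`
  obtain ⟨lχ, hlχ, hχmod⟩ : ∃ lχ : ℝ, 0 < lχ ∧ ∀ p q : ℝ × T3, p.1 ∈ Icc 0 τ → q.1 ∈ Icc 0 τ →
      dist p q ≤ lχ → |χ p - χ q| ≤ η' := by
    have hK : IsCompact (Icc (0 : ℝ) τ ×ˢ (univ : Set T3)) := isCompact_Icc.prod isCompact_univ
    obtain ⟨d, hd, H⟩ := Metric.uniformContinuousOn_iff_le.1
      (hK.uniformContinuousOn_of_continuous hχ.continuousOn) η' hη'0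
    refine ⟨d, hd, fun p q hp hq hpq => ?_⟩
    have := H p ⟨hp, mem_univ _⟩ q ⟨hq, mem_univ _⟩ hpq
    rwa [Real.dist_eq] at this
  obtain ⟨lg, hlg, hgmod⟩ : ∃ lg : ℝ, 0 < lg ∧ ∀ x y : ℝ, x ∈ Icc 0 (σ ^ 3 * (3 / (Real.pi * r ^ 3))) →
      y ∈ Icc 0 (σ ^ 3 * (3 / (Real.pi * r ^ 3))) → |x - y| ≤ lg → |g x - g y| ≤ η' := by
    obtain ⟨d, hd, H⟩ := Metric.uniformContinuousOn_iff_le.1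
      ((isCompact_Icc (a := (0 : ℝ)) (b := σ ^ 3 * (3 / (Real.pi * r ^ 3)))).uniformContinuousOn_of_continuous
        hg.continuousOn) η' hη'0
    refine ⟨d, hd, fun x y hx hy hxy => ?_⟩
    have := H x hx y hy (by rwa [Real.dist_eq])
    rwa [Real.dist_eq] at this
  -- the Lipschitz scale of the density reading and the good-window threshold `λ`
  obtain ⟨Mg, hMgeq, hMg0⟩ : ∃ Mg : ℝ, Mg = σ ^ 3 * (3 / (Real.pi * r ^ 4)) ∧ 0 < Mg := ⟨_, rfl, by positivity⟩
  obtain ⟨lam, hlam0, hlam1, hlam2⟩ : ∃ lam : ℝ, 0 < lam ∧ lam ≤ lχ / 4 ∧ Mg * lam ≤ lg / 4 := by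
    refine ⟨min (lχ / 4) (lg / (4 * Mg)), by positivity, min_le_left _ _, ?_⟩
    calc Mg * min (lχ / 4) (lg / (4 * Mg)) ≤ Mg * (lg / (4 * Mg)) :=
          mul_le_mul_of_nonneg_left (min_le_right _ _) hMg0.le
      _ = lg / 4 := by field_simp
  -- the cell size
  refine ⟨min (lχ / 4) (lg / (8 * Mg)), by positivity, ?_⟩
  intro r' hr' hr'lt
  have hr'1 : r' ≤ lχ / 4 := hr'lt.le.trans (min_le_left _ _)
  have hr'2 : Mg * (2 * r') ≤ lg / 4 := by
    have e1 : r' ≤ lg / (8 * Mg) := hr'lt.le.trans (min_le_right _ _)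
    calc Mg * (2 * r') ≤ Mg * (2 * (lg / (8 * Mg))) := by gcongr
      _ = lg / 4 := by field_simp; ring
  have hlr : lam + r' ≤ lχ := by linarith
  -- the particle-number threshold: `(N+1)^{-1/3} ≤ c`
  obtain ⟨Q, hQeq, hQ0⟩ : ∃ Q : ℝ, Q = Cχ * Cg / (θ * lam) * (τ * (1 / 2 + KE')) ∧ 0 ≤ Q :=
    ⟨_, rfl, by positivity⟩
  obtain ⟨c, hc0, hc1, hc2, hc3, hc4⟩ : ∃ c : ℝ, 0 < c ∧ c ≤ lχ / (a * 2) ∧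
      c ≤ lg / 8 / (a * (Mg * (KE' + 1))) ∧ c ≤ η / 4 / (σ * (2 * (Cχ * Cg) + 1)) ∧
      c ≤ η / 4 / (σ * (Q + 1)) := by
    refine ⟨min (min (lχ / (a * 2)) (lg / 8 / (a * (Mg * (KE' + 1)))))
      (min (η / 4 / (σ * (2 * (Cχ * Cg) + 1))) (η / 4 / (σ * (Q + 1)))), by positivity, ?_, ?_, ?_, ?_⟩
    · exact (min_le_left _ _).trans (min_le_left _ _)
    · exact (min_le_left _ _).trans (min_le_right _ _)
    · exact (min_le_right _ _).trans (min_le_left _ _)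
    · exact (min_le_right _ _).trans (min_le_right _ _)
  obtain ⟨Nc, hNc⟩ := exists_nat_rpow_neg_third_le hc0
  refine ⟨max (max N₅ NE) Nc, fun N hN => ?_⟩
  have hN₅ : N₅ ≤ N := le_trans ((le_max_left _ _).trans (le_max_left _ _)) hN
  have hNE : NE ≤ N := le_trans ((le_max_right _ _).trans (le_max_left _ _)) hN
  have hν : ((N + 1 : ℕ) : ℝ) ^ (-(1 / 3 : ℝ)) ≤ c := hNc N (le_trans (le_max_right _ _) hN)
  -- consequences: `ε` and `w` are small
  have hε0 : 0 ≤ hsDiameter σ N := (hsDiameter_pos hσ N).le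
  have hεle : hsDiameter σ N ≤ σ * c := mul_le_mul_of_nonneg_left hν hσ.le
  have hw0 : 0 ≤ windowLen N τ a := (windowLen_pos N hτ ha').le
  have hwle : windowLen N τ a ≤ a * c :=
    (windowLen_le N hτ ha').trans (mul_le_mul_of_nonneg_left hν ha'.le)
  have hw1 : windowLen N τ a ≤ lχ := by
    have := mul_le_of_le_mul_of_le_div hw0 (by norm_num : (1 : ℝ) ≤ 2) two_pos ha' hwle hc1
    linarith
  have hw2 : Mg * (1 / 2 + KE') * windowLen N τ a ≤ lg / 8 :=
    mul_le_of_le_mul_of_le_div hw0 (mul_le_mul_of_nonneg_left (by linarith) hMg0.le) (by positivity) ha' hwle hc2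
  have hε1 : 2 * (Cχ * Cg) * hsDiameter σ N ≤ η / 4 :=
    mul_le_of_le_mul_of_le_div hε0 (le_add_of_nonneg_right zero_le_one) (by positivity) hσ hεle hc3
  have hε2 : Q * hsDiameter σ N ≤ η / 4 :=
    mul_le_of_le_mul_of_le_div hε0 (le_add_of_nonneg_right zero_le_one) (by positivity) hσ hεle hc4
  have h3 : Cχ * Cg / (θ * lam) * (hsDiameter σ N * τ * (1 / 2 + KE')) ≤ η / 4 := by
    rw [show Cχ * Cg / (θ * lam) * (hsDiameter σ N * τ * (1 / 2 + KE')) = Q * hsDiameter σ N by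
      rw [hQeq]; ring]
    exact hε2
  have hdens : σ ^ 3 * (3 / (Real.pi * r ^ 4)) * (windowLen N τ a * (1 / 2 + KE') + lam + 2 * r') ≤ lg := by
    rw [← hMgeq, show Mg * (windowLen N τ a * (1 / 2 + KE') + lam + 2 * r') =
      Mg * (1 / 2 + KE') * windowLen N τ a + Mg * lam + Mg * (2 * r') by ring]
    linarith
  -- the event inclusion: off the bad set and the two tail events the pathwise bound is `≤ η`
  have hincl : {z | η < |Literature.MathematicalPhysics.KineticTheory.collisionSum σ N (Φ N) τ χ g (fun _ => 1) r z -
      windowSum σ N (Φ N) r' τ a (hazardWeight σ N χ g r r' τ a) (windowCollisions σ N (Φ N) τ a) z|} ⊆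
      (Φ N).goodᶜ ∪ ({z | Kb < hsDiameter σ N / (N + 1 : ℝ) *
          ∑ i : Fin (N + 1), ∑ k ∈ Finset.range (windowNum N τ a), windowCollisions σ N (Φ N) τ a i k z ^ 2} ∪
        {z | KE < ((N : ℝ) + 1)⁻¹ * configEnergy ((Φ N).flow 0 z)}) := by
    intro z hz
    rw [mem_setOf_eq] at hz
    by_contra hcon
    simp only [mem_union, mem_compl_iff, mem_setOf_eq, not_or, not_not, not_lt] at hcon
    obtain ⟨hgood, hSle, hEle⟩ := hcon
    rw [(Φ N).flow_zero z hgood] at hEle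
    have hle := abs_collisionSum_sub_windowSum_le (Φ N) hgood hσ hσ2 hτ ha' hr hr' χ g hCχ0 hCg0 hCg hCχ
      hχmod hgmod (hEle.trans hKE') (hSle.trans hKb') hη'0.le hθ0 hlam0 hw1 hlr hdens hε1 h2 h3
    exact absurd hz (not_lt.2 hle)
  -- the union bound
  calc localGibbsLaw σ a₀ u₀ θ₀ N (Φ N)
        {z | η < |Literature.MathematicalPhysics.KineticTheory.collisionSum σ N (Φ N) τ χ g (fun _ => 1) r z -
          windowSum σ N (Φ N) r' τ a (hazardWeight σ N χ g r r' τ a) (windowCollisions σ N (Φ N) τ a) z|}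
      ≤ localGibbsLaw σ a₀ u₀ θ₀ N (Φ N) ((Φ N).goodᶜ ∪
          ({z | Kb < hsDiameter σ N / (N + 1 : ℝ) * ∑ i : Fin (N + 1), ∑ k ∈ Finset.range (windowNum N τ a),
              windowCollisions σ N (Φ N) τ a i k z ^ 2} ∪
            {z | KE < ((N : ℝ) + 1)⁻¹ * configEnergy ((Φ N).flow 0 z)})) := measure_mono hincl
    _ ≤ localGibbsLaw σ a₀ u₀ θ₀ N (Φ N) (Φ N).goodᶜ +
        (localGibbsLaw σ a₀ u₀ θ₀ N (Φ N) {z | Kb < hsDiameter σ N / (N + 1 : ℝ) *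
            ∑ i : Fin (N + 1), ∑ k ∈ Finset.range (windowNum N τ a), windowCollisions σ N (Φ N) τ a i k z ^ 2} +
          localGibbsLaw σ a₀ u₀ θ₀ N (Φ N) {z | KE < ((N : ℝ) + 1)⁻¹ * configEnergy ((Φ N).flow 0 z)}) :=
        (measure_union_le _ _).trans (add_le_add le_rfl (measure_union_le _ _))
    _ ≤ 0 + (ENNReal.ofReal (δ / 4) + ENNReal.ofReal (δ / 4)) :=
        add_le_add (le_of_eq (localGibbsLaw_compl_good_eq_zero _)) (add_le_add (hS5 N hN₅) (hKE N hNE 0))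
    _ ≤ ENNReal.ofReal δ := by
        rw [zero_add, ← ENNReal.ofReal_add (by positivity) (by positivity)]
        exact ENNReal.ofReal_le_ofReal (by linarith)

end Summit.AtomisticToContinuum.HydrodynamicLimit.Theorems.CollisionRate

end
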